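import Mathlib.Analysis.SpecialFunctions.BinaryEntropy
import Literature.Computability.AlgebraicComplexity.LaserMethodBigCW
import Literature.Computability.AlgebraicComplexity.MaxEntropyGivenMarginals
import HarnessLib

/-!
# Stub B2 for the crux `PerfectAmortisation` (line `registered`): entropy evaluation of the
far-rectangular joint type on the Coppersmith–Winograd support

For the first-power laser method on `CW_q` with the joint type
`Q = (m on (1,1,0), m on (0,1,1), k·m on (1,0,1))`, `N = (k+2)·m`, `P = Q/N`, this file evaluates
the exponent `min_m H(P_m) − Γ_S(P)` of the free-diagonal bound: writing `θ = 1/(k+2)` one has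
`P(1,1,0) = P(0,1,1) = θ`, `P(1,0,1) = kθ = 1 − 2θ` and `P = 0` elsewhere, so

* the marginals are `(θ, 1−θ, 0)`, `(1−2θ, 2θ, 0)`, `(θ, 1−θ, 0)` with Shannon entropies (bits)
  `h(θ)/log 2`, `h(2θ)/log 2`, `h(θ)/log 2` (`h = Real.binEntropy`, nats);
* `h(θ) ≤ h(2θ)` because `θ ≤ 1/3`;
* the penalty `Γ_S(P) = max_{P' ∈ D(P)} H(P') − H(P)` (`maxEntropyPenalty cwSupport₃ P`) is `≤ 0`
  (hence `= 0`): a distribution supported in `{i+j+l = 2}` with the marginals of `P` has no mass on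
  level `2` (the marginals vanish there), hence lives on the three matrix patterns, where it is
  determined by its marginals, i.e. `D(P) = {P}`.

Hence `log 2 · (min_m H(P_m) − Γ_S(P)) ≥ h(1/(k+2))`, which is `stub_cwRectEntropy` verbatim.
-/

set_option linter.dupNamespace false
-- (single-conjunct summit: the namespace repeats `MatrixMultiplication`)

namespace Summit.MatrixMultiplication.MatrixMultiplication.Theorems.PerfectAmortisation

open Literature.Computability.AlgebraicComplexity

/-- `H(p, 1 − p, 0) = h(p) / log 2` (Shannon entropy in bits of a two-point law padded by a zero).
[folklore] -/
theorem shannonEntropy_vec3_eq_binEntropy (p : ℝ) :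
    shannonEntropy ![p, 1 - p, 0] = Real.binEntropy p / Real.log 2 := by
  rw [shannonEntropy_def, Fin.sum_univ_three, Real.binEntropy_eq_negMulLog_add_negMulLog_one_sub]
  simp

/-- `H(1 − p, p, 0) = h(p) / log 2`. [folklore] -/
theorem shannonEntropy_vec3_eq_binEntropy' (p : ℝ) :
    shannonEntropy ![1 - p, p, 0] = Real.binEntropy p / Real.log 2 := by
  rw [shannonEntropy_def, Fin.sum_univ_three, Real.binEntropy_eq_negMulLog_add_negMulLog_one_sub]
  simp [add_comm]

/-- `h(θ) ≤ h(2θ)` for `0 ≤ θ ≤ 1/3`: if `θ ≤ 1/4` both points lie in `[0, 1/2]` where `h`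
increases; otherwise `h(2θ) = h(1 − 2θ)` with `θ ≤ 1 − 2θ ≤ 1/2`. [folklore] -/
theorem binEntropy_le_binEntropy_two_mul {θ : ℝ} (h0 : 0 ≤ θ) (h3 : θ ≤ 1 / 3) :
    Real.binEntropy θ ≤ Real.binEntropy (2 * θ) := by
  have h2 : (2 : ℝ)⁻¹ = 1 / 2 := by norm_num
  rcases le_or_gt θ (1 / 4) with h4 | h4
  · exact Real.binEntropy_strictMonoOn.monotoneOn ⟨h0, by rw [h2]; linarith⟩
      ⟨by linarith, by rw [h2]; linarith⟩ (by linarith)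
  · rw [← Real.binEntropy_one_sub (2 * θ)]
    exact Real.binEntropy_strictMonoOn.monotoneOn ⟨h0, by rw [h2]; linarith⟩
      ⟨by linarith, by rw [h2]; linarith⟩ (by linarith)

/-- The three marginals of the law `θ` on `(1,1,0)` and `(0,1,1)`, `1 − 2θ` on `(1,0,1)`:
`(θ, 1−θ, 0)`, `(1−2θ, 2θ, 0)`, `(θ, 1−θ, 0)`. [folklore] -/
theorem marginalDist_rect {θ : ℝ} {P : Fin 3 × Fin 3 × Fin 3 → ℝ}
    (hP : ∀ s, P s = if s = (1, 1, 0) then θ else if s = (0, 1, 1) then θ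
      else if s = (1, 0, 1) then 1 - 2 * θ else 0) :
    marginalDist₁ P = ![θ, 1 - θ, 0] ∧ marginalDist₂ P = ![1 - 2 * θ, 2 * θ, 0] ∧
      marginalDist₃ P = ![θ, 1 - θ, 0] := by
  -- nine coordinates; `simp` evaluates the sums, `ring` closes the three that need arithmetic
  refine ⟨?_, ?_, ?_⟩ <;> funext i <;> fin_cases i <;>
    simp [marginalDist₁, marginalDist₂, marginalDist₃, Fin.sum_univ_three, hP] <;> ring

/-- The law vanishes off the support `{i + j + l = 2}` of `CW_q`. [folklore] -/
theorem rect_eq_zero_of_not_mem {θ : ℝ} {P : Fin 3 × Fin 3 × Fin 3 → ℝ}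
    (hP : ∀ s, P s = if s = (1, 1, 0) then θ else if s = (0, 1, 1) then θ
      else if s = (1, 0, 1) then 1 - 2 * θ else 0) {s : Fin 3 × Fin 3 × Fin 3}
    (hs : s ∉ cwSupport₃) : P s = 0 := by
  rw [mem_cwSupport₃_iff] at hs
  push Not at hs
  rw [hP]
  simp [hs.1, hs.2.1, hs.2.2.1]

/-- **`D(P) = {P}`**: a distribution supported in `{i + j + l = 2}` with the marginals of the law
above coincides with it — the level-`2` marginals vanish, killing the three corner points, and then
each matrix pattern is read off from one level-`0` marginal. [folklore] -/
theorem eq_of_mem_sameMarginalsOn_rect {θ : ℝ} {P P' : Fin 3 × Fin 3 × Fin 3 → ℝ}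
    (hP : ∀ s, P s = if s = (1, 1, 0) then θ else if s = (0, 1, 1) then θ
      else if s = (1, 0, 1) then 1 - 2 * θ else 0)
    (hP' : P' ∈ sameMarginalsOn cwSupport₃ P) : P' = P := by
  obtain ⟨-, hoff, h₁, h₂, h₃⟩ := hP'
  obtain ⟨hm₁, hm₂, hm₃⟩ := marginalDist_rect hP
  -- the off-support zeros of `P'`
  have z : ∀ a b c : Fin 3, (a : ℕ) + b + c ≠ 2 → P' (a, b, c) = 0 := fun a b c h =>
    hoff _ (mt mem_cwSupport₃.1 h)
  -- the six marginal equations we use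
  have e₁ : marginalDist₁ P' 2 = 0 := by rw [h₁, hm₁]; simp
  have e₂ : marginalDist₂ P' 2 = 0 := by rw [h₂, hm₂]; simp
  have e₃ : marginalDist₃ P' 2 = 0 := by rw [h₃, hm₃]; simp
  have f₁ : marginalDist₁ P' 0 = θ := by rw [h₁, hm₁]; simp
  have f₂ : marginalDist₂ P' 0 = 1 - 2 * θ := by rw [h₂, hm₂]; simp
  have f₃ : marginalDist₃ P' 0 = θ := by rw [h₃, hm₃]; simp
  simp (disch := decide) only [marginalDist₁, marginalDist₂, marginalDist₃, Fin.sum_univ_three, z,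
    add_zero, zero_add] at e₁ e₂ e₃ f₁ f₂ f₃
  -- `e₁ : P' (2,0,0) = 0`, `e₂ : P' (0,2,0) = 0`, `e₃ : P' (0,0,2) = 0`,
  -- `f₁ : P' (0,0,2) + P' (0,1,1) + P' (0,2,0) = θ`, …
  have p011 : P' (0, 1, 1) = θ := by linarith
  have p101 : P' (1, 0, 1) = 1 - 2 * θ := by linarith
  have p110 : P' (1, 1, 0) = θ := by linarith
  funext s
  by_cases hs : s ∈ cwSupport₃
  · rw [hP]
    rw [mem_cwSupport₃_iff] at hs
    rcases hs with rfl | rfl | rfl | rfl | rfl | rfl <;> simp [p011, p101, p110, e₁, e₂, e₃]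
  · rw [hoff s hs, rect_eq_zero_of_not_mem hP hs]

/-- **The penalty vanishes**: `Γ_S(P) = max_{D(P)} H − H(P) ≤ 0` for the law above with
`0 ≤ θ`, `2θ ≤ 1` (it is a distribution supported in `S`, and `D(P) = {P}`). [folklore] -/
theorem maxEntropyPenalty_rect_nonpos {θ : ℝ} {P : Fin 3 × Fin 3 × Fin 3 → ℝ}
    (hP : ∀ s, P s = if s = (1, 1, 0) then θ else if s = (0, 1, 1) then θ
      else if s = (1, 0, 1) then 1 - 2 * θ else 0) (h0 : 0 ≤ θ) (h1 : 2 * θ ≤ 1) :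
    maxEntropyPenalty cwSupport₃ P ≤ 0 := by
  have hsimplex : P ∈ stdSimplex ℝ (Fin 3 × Fin 3 × Fin 3) := by
    refine ⟨fun s => ?_, ?_⟩
    · rw [hP]
      split_ifs <;> linarith
    · rw [sum_triple_eq]
      simp [Fin.sum_univ_three, hP]
      ring
  have hsupp : ∀ x, x ∉ cwSupport₃ → P x = 0 := fun x hx => rect_eq_zero_of_not_mem hP hx
  have hle : maxEntropyGivenMarginals cwSupport₃ P ≤ shannonEntropy P :=
    maxEntropyGivenMarginals_le ⟨P, self_mem_sameMarginalsOn hsimplex hsupp⟩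
      fun P' hP' => (congrArg shannonEntropy (eq_of_mem_sameMarginalsOn_rect hP hP')).le
  exact sub_nonpos.2 hle

/-- **Stub B2 (entropy evaluation of the far-rectangular joint type).**  For `P = Q/N`
(`P(1,1,0) = P(0,1,1) = θ`, `P(1,0,1) = kθ`, `θ = 1/(k+2)`): the marginals are `(θ, 1−θ, 0)`,
`(kθ, 2θ, 0)`, `(θ, 1−θ, 0)` with Shannon entropies (bits) `h(θ)/log 2`, `h(2θ)/log 2`,
`h(θ)/log 2`; `h(2θ) ≥ h(θ)` for `0 ≤ θ ≤ 1/3`; and the penalty `Γ_S(P) = max_{P'∈D} H(P') − H(P)`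
vanishes because a distribution on `{i+j+l=2}` whose marginals kill level `2` is supported on the
three matrix patterns and is then determined by its marginals (`P' = P`).  Hence
`log 2 · (min_m H(P_m) − Γ_S(P)) ≥ h(1/(k+2))` (`Real.binEntropy`, nats). [folklore] -/
theorem stub_cwRectEntropy :
    ∀ m k : ℕ, 1 ≤ m → 1 ≤ k → ∀ P : Fin 3 × Fin 3 × Fin 3 → ℝ,
      (∀ s, P s = ((if s = (1, 1, 0) then m else if s = (0, 1, 1) then m
          else if s = (1, 0, 1) then k * m else 0 : ℕ) : ℝ) / (((k + 2) * m : ℕ) : ℝ)) →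
      Real.binEntropy (1 / ((k : ℝ) + 2)) ≤
        Real.log 2 * (min (shannonEntropy (marginalDist₁ P))
          (min (shannonEntropy (marginalDist₂ P)) (shannonEntropy (marginalDist₃ P))) -
          maxEntropyPenalty cwSupport₃ P) := by
  intro m k hm hk P hP
  have hk1 : (1 : ℝ) ≤ k := by exact_mod_cast hk
  have hk0 : (k : ℝ) + 2 ≠ 0 := by positivity
  have hm0 : (m : ℝ) ≠ 0 := by exact_mod_cast (by omega : m ≠ 0)
  -- the law in terms of `θ = 1/(k+2)`
  have hPθ : ∀ s, P s = if s = (1, 1, 0) then 1 / ((k : ℝ) + 2)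
      else if s = (0, 1, 1) then 1 / ((k : ℝ) + 2)
      else if s = (1, 0, 1) then 1 - 2 * (1 / ((k : ℝ) + 2)) else 0 := by
    intro s
    rw [hP s]
    push_cast
    split_ifs
    · field_simp
    · field_simp
    · field_simp
      ring
    · simp
  have hθ0 : (0 : ℝ) ≤ 1 / ((k : ℝ) + 2) := by positivity
  have hθ3 : 1 / ((k : ℝ) + 2) ≤ 1 / 3 :=
    one_div_le_one_div_of_le (by norm_num) (by linarith)
  obtain ⟨hm₁, hm₂, hm₃⟩ := marginalDist_rect hPθ
  have hpen : maxEntropyPenalty cwSupport₃ P ≤ 0 :=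
    maxEntropyPenalty_rect_nonpos hPθ hθ0 (by linarith)
  have hmono := binEntropy_le_binEntropy_two_mul hθ0 hθ3
  have hlog : 0 < Real.log 2 := Real.log_pos one_lt_two
  rw [hm₁, hm₂, hm₃, shannonEntropy_vec3_eq_binEntropy, shannonEntropy_vec3_eq_binEntropy',
    min_eq_right (div_le_div_of_nonneg_right hmono hlog.le), min_self, mul_sub,
    mul_div_cancel₀ _ hlog.ne']
  have h2 : Real.log 2 * maxEntropyPenalty cwSupport₃ P ≤ 0 :=
    mul_nonpos_of_nonneg_of_nonpos hlog.le hpen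
  linarith

end Summit.MatrixMultiplication.MatrixMultiplication.Theorems.PerfectAmortisation
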